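import Summits.RiemannHypothesis.RiemannHypothesis.Theses.WeilComb
import Summits.RiemannHypothesis.RiemannHypothesis.Theorems.WeilCombCombShapePositivityStubPolarCS
import Summits.RiemannHypothesis.RiemannHypothesis.Theorems.WeilCombCombShapePositivityStubPoincareExplicit
import Summits.RiemannHypothesis.RiemannHypothesis.Theorems.WeilCombCombShapePositivityStubHelsonUpper
import Summits.RiemannHypothesis.RiemannHypothesis.Theorems.WeilCombCombShapePositivityStubArchWindow
import Summits.RiemannHypothesis.RiemannHypothesis.Theorems.WeilCombCombShapePositivityExactPrimeWindow
import Summits.RiemannHypothesis.RiemannHypothesis.Theorems.WeilCombCombShapePositivityPolarExact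
import Summits.RiemannHypothesis.RiemannHypothesis.Theorems.WeilCombCombShapePositivityPoleCoefficient
import Summits.RiemannHypothesis.RiemannHypothesis.Theorems.WeilCombCombShapeAdmissible
import Literature.NumberTheory.LFunctions.WeilExplicit
import Literature.NumberTheory.LFunctions.WeilMellinBounds
import Literature.NumberTheory.LFunctions.WeilArchimedeanMoments
import Literature.Analysis.SpecialFunctions.DigammaVerticalSeries

/-!
# The coercivity dichotomy on the exact window ("PerronConeCoercivity", explicit constants)
(crux `WeilComb.CombShapePositivity`, item stmt-RiemannHypothesis-11229, line `Sketch`; first analytic layer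
of the route's Theorem B = `2ε(M+1) ≤ 1 ⇒ 0 ≤ Re Q(comb)`, after the exact identity layer p90904/p91841/p91497)

Notation. `φ₀(u) = expNegInvGlue (1 - u²)`, `φ_ε(t) = ε⁻¹ φ₀(t/ε)`, comb `g = Σ_{m ≤ M} a_m φ_ε(· − log m)`,
`k = g ⋆ g̃`, `Q(g) = W(k)`, `N₀ = ‖φ₀‖₂²`, `U = ε⁻¹N₀ = ψ_ε(0)`, `F_ε = ∫ φ₀(u) cosh(εu/2) du = φ̂_ε(0) = φ̂_ε(1) > 0`,
`L = Σ‖a_m‖²`, Helson form `H`, Dirichlet energy `D = Σ_m Σ_{n ≤ M/m} Λ(n)‖a(nm) − n^{-1/2}a(m)‖²`,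
`A∓ = Σ ‖a_m‖ m^{∓1/2}`, `ρ(u) = Re ψ(1/4 + iu/2)` (`reDigammaQuarter`),
`archPlus(a) = (1/2π)∫|ĝ(1/2+iu)|²(ρ(u) − ρ(0))du ≥ 0`, coherence deficit
`Δ(a) = (log M + 1 + log π − ρ(0))L − archPlus(a)/U`, and the explicit constant
`C = 16 F_ε⁴(εM)²/N₀² + (1 + 2(log 4 + 4))/4` (numerically `≈ 11.7` at `εM = 1/2`).

**Statements.**
* `window_coercivity`: for `0 < ε`, `1 ≤ M`, `2ε(M+1) ≤ 1` and every `a`,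
  `U · (D/2 − Δ(a) − C·L) ≤ Re Q(g)`.
* `window_dichotomy`: hence OFF the soft cone `{D ≤ 2Δ + 2C L}` the window cell holds: `0 ≤ Re Q(g)`.
  So Theorem B is EQUIVALENT to its restriction to the soft cone (near-Perron / index-coherent vectors, where
  `D` is small or `archPlus` falls short of the diagonal); this is the localisation lever (L4) of the crux idea
  `tapered-perron-localisation` and the "PerronConeCoercivity" step of the route's two-layer plan, kernel-checked.

**Proof** (all ingredients landed): exact three-term identity on the window
(`weilQuadratic_comb_re_exactWindow`: `Re Q = Re P(k) − U·H + Re W_∞(k)`, prime term exact); polar term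
`Re P(k) = 2F_ε² Re(A₋' conj A₊') ≥ −2F_ε² A₋A₊` (`weilPolarTerm_comb_re`, `weilMellin_dilBump_zero_one`);
pole shadow `2F_ε²A₋A₊ ≤ U·D/2 + C·U·L` from `(A₋A₊)² ≤ 4ML(ML + X)` (`stub_polarCS`), the explicit Poincaré
inequality `X ≤ 2M·D + 2(log 4+4)M·L` (`stub_poincare_explicit`) and AM–GM with parameter `t = 8F_ε²M/U`;
Helson `H ≤ (log M + 1)L − D` (`stub_helson_upper`, ground-state identity + Rosser–Schoenfeld (3.24));
archimedean term `Re W_∞(k) = archPlus + (ρ(0) − log π)·U·L` (`stub_arch_window`). Summing: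
`Re Q ≥ −U·D/2 − C·U·L − U(log M + 1)L + U·D + archPlus + (ρ(0) − log π)U·L = U(D/2 − Δ − C·L)`.

Remark (recorded for the next layer): on the window `Q/U − D/2 + Δ = Re P(k)/U + D/2 + Σ_m (log M + 1 − log m − ψ₁(M/m))‖a_m‖²`
— the archimedean form cancels identically, so the dichotomy constant is a statement about the POLE alone; the
crude `C ≈ 11.7` wastes the pole's sign, which is load-bearing on the cone (Disproof N3).
-/

noncomputable section

-- the sub-problem path `RiemannHypothesis/RiemannHypothesis` (single-conjunct summit, D-0017) duplicates a namespace
set_option linter.dupNamespace false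

open scoped BigOperators ComplexConjugate
open Complex MeasureTheory

namespace Summit.RiemannHypothesis.RiemannHypothesis.Theorems.WeilCombBohrFejer

open Literature.NumberTheory.LFunctions
open Literature.Analysis.SpecialFunctions (reDigammaQuarter reDigammaQuarter_zero_le)

/-- `‖φ₀‖₂² > 0` for the fixed bump (`φ₀(0) = expNegInvGlue 1 > 0`, `φ₀` continuous with compact support). [folklore] -/
theorem weilNorm2Sq_shapeBump_pos :
    0 < weilNorm2Sq (fun u : ℝ => ((expNegInvGlue (1 - u ^ 2) : ℝ) : ℂ)) := by
  unfold weilNorm2Sq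
  have hW := Summit.RiemannHypothesis.RiemannHypothesis.Theorems.weilComb_shapeBump_isWeilTest
  have hc : Continuous fun u : ℝ => ‖((expNegInvGlue (1 - u ^ 2) : ℝ) : ℂ)‖ ^ 2 :=
    (hW.1.continuous.norm).pow 2
  have hs : HasCompactSupport fun u : ℝ => ‖((expNegInvGlue (1 - u ^ 2) : ℝ) : ℂ)‖ ^ 2 :=
    hW.2.norm.comp_left (g := fun r : ℝ => r ^ 2) (by simp)
  refine hc.integral_pos_of_hasCompactSupport_nonneg_nonzero hs (fun u => by positivity) (x := 0) ?_
  have h1 : 0 < expNegInvGlue (1 - (0 : ℝ) ^ 2) := expNegInvGlue.pos_of_pos (by norm_num)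
  rw [Complex.norm_real, Real.norm_eq_abs, abs_of_pos h1]
  positivity

/-- Triangle inequality for the two Dirichlet sums of the pole: `‖Σ a_m (√m)^{∓1}‖ ≤ A∓`. -/
private theorem norm_polarSums_le_dich (M : ℕ) (a : ℕ → ℂ) :
    ‖∑ m ∈ Finset.Icc 1 M, a m * ((Real.sqrt (m : ℝ) : ℝ) : ℂ)⁻¹‖ ≤
        ∑ m ∈ Finset.Icc 1 M, ‖a m‖ / Real.sqrt m ∧
      ‖∑ m ∈ Finset.Icc 1 M, a m * ((Real.sqrt (m : ℝ) : ℝ) : ℂ)‖ ≤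
        ∑ m ∈ Finset.Icc 1 M, ‖a m‖ * Real.sqrt m := by
  constructor
  · refine (norm_sum_le _ _).trans (le_of_eq (Finset.sum_congr rfl fun m _ => ?_))
    rw [norm_mul, norm_inv, Complex.norm_real, Real.norm_eq_abs, abs_of_nonneg (Real.sqrt_nonneg _),
      div_eq_mul_inv]
  · refine (norm_sum_le _ _).trans (le_of_eq (Finset.sum_congr rfl fun m _ => ?_))
    rw [norm_mul, Complex.norm_real, Real.norm_eq_abs, abs_of_nonneg (Real.sqrt_nonneg _)]

/-- `Re(F · conj F · z) = F² Re z` for real `F`. -/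
private theorem re_ofReal_mul_conj_mul_dich (F : ℝ) (z : ℂ) :
    ((F : ℂ) * conj (F : ℂ) * z).re = F ^ 2 * z.re := by
  rw [Complex.conj_ofReal, ← Complex.ofReal_mul, Complex.re_ofReal_mul]
  ring

/-- Pure real-arithmetic core of the dichotomy: with `U > 0`, `F`, `M > 0`, the pole-shadow bound
`(A₋A₊)² ≤ 4ML(ML + X)`, Poincaré `X ≤ 2MD + C_P ML` and AM–GM at `t = 8F²M/U`:
`2F² A₋A₊ ≤ U·D/2 + (16F⁴M²/U² + (1 + C_P)/4)·U·L`. -/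
private theorem polar_shadow_le_dich {U F M L X D AmAp CP : ℝ} (hU : 0 < U) (hM : 0 < M) (hL : 0 ≤ L) (hD : 0 ≤ D)
    (hCP : 0 ≤ CP) (hA0 : 0 ≤ AmAp) (hCS : AmAp ^ 2 ≤ 4 * M * L * (M * L + X))
    (hPo : X ≤ 2 * M * D + CP * M * L) :
    2 * F ^ 2 * AmAp ≤ U * D / 2 + (16 * F ^ 4 * M ^ 2 / U ^ 2 + (1 + CP) / 4) * (U * L) := by
  -- `Y = (1 + C_P) L + 2 D ≥ 0`, `(A₋A₊)² ≤ 4 M² L Y`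
  set Y : ℝ := (1 + CP) * L + 2 * D with hY
  have hY0 : 0 ≤ Y := by positivity
  have hCS' : AmAp ^ 2 ≤ 4 * M ^ 2 * L * Y := by
    calc AmAp ^ 2 ≤ 4 * M * L * (M * L + X) := hCS
      _ ≤ 4 * M * L * (M * L + (2 * M * D + CP * M * L)) :=
          mul_le_mul_of_nonneg_left (by linarith) (by positivity)
      _ = 4 * M ^ 2 * L * Y := by rw [hY]; ring
  -- AM–GM with the parameter `t = 8 F² M / U > 0` … unless `F = 0`, which is trivial
  rcases eq_or_ne F 0 with hF | hF
  · subst hF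
    have : 0 ≤ U * D / 2 + (16 * (0 : ℝ) ^ 4 * M ^ 2 / U ^ 2 + (1 + CP) / 4) * (U * L) := by positivity
    simpa using this
  have hF2 : 0 < F ^ 2 := by positivity
  set t : ℝ := 8 * F ^ 2 * M / U with ht
  have ht0 : 0 < t := by positivity
  -- `A₋A₊ ≤ M (t L + Y / t)` since `(M(tL + Y/t))² − 4M²LY = M²(tL − Y/t)² ≥ 0`
  have hB0 : 0 ≤ M * (t * L + Y / t) := by positivity
  have hAM : AmAp ≤ M * (t * L + Y / t) := by
    refine (sq_le_sq₀ hA0 hB0).1 (hCS'.trans ?_)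
    have e : (M * (t * L + Y / t)) ^ 2 - 4 * M ^ 2 * L * Y = M ^ 2 * (t * L - Y / t) ^ 2 := by
      field_simp
      ring
    nlinarith [e, sq_nonneg (M * (t * L - Y / t))]
  -- evaluate `2F² M (tL + Y/t)` at `t = 8F²M/U`
  have key : 2 * F ^ 2 * (M * (t * L + Y / t)) =
      U * D / 2 + (16 * F ^ 4 * M ^ 2 / U ^ 2 + (1 + CP) / 4) * (U * L) := by
    rw [ht, hY]
    field_simp
    ring
  calc 2 * F ^ 2 * AmAp ≤ 2 * F ^ 2 * (M * (t * L + Y / t)) :=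
        mul_le_mul_of_nonneg_left hAM (by positivity)
    _ = _ := key

/-- **PerronConeCoercivity (explicit).** For `0 < ε`, `1 ≤ M`, `2ε(M+1) ≤ 1` and every `a : ℕ → ℂ`:
`ε⁻¹‖φ₀‖₂² · ( D(a)/2 − Δ(a) − C·‖a‖² ) ≤ Re Q(g)`, with the coherence deficit
`Δ(a) = (log M + 1 + log π − ρ(0))‖a‖² − (ε/‖φ₀‖₂²)·(1/2π)∫|ĝ(1/2+iu)|²(ρ(u) − ρ(0))du` and
`C = 16F_ε⁴(εM)²/‖φ₀‖₂⁴ + (1 + 2(log 4 + 4))/4`. [folklore] -/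
theorem window_coercivity : ∀ ε : ℝ, 0 < ε → ∀ (M : ℕ) (a : ℕ → ℂ), 1 ≤ M → 2 * ε * ((M : ℝ) + 1) ≤ 1 →
    ε⁻¹ * weilNorm2Sq (fun u : ℝ => ((expNegInvGlue (1 - u ^ 2) : ℝ) : ℂ)) *
        ((∑ m ∈ Finset.Icc 1 M, ∑ n ∈ Finset.Icc 1 (M / m),
            (ArithmeticFunction.vonMangoldt n : ℝ) * ‖a (n * m) - ((Real.sqrt n : ℂ))⁻¹ * a m‖ ^ 2) / 2 -
          ((Real.log M + 1 + Real.log Real.pi - reDigammaQuarter 0) * (∑ m ∈ Finset.Icc 1 M, ‖a m‖ ^ 2) -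
            ε / weilNorm2Sq (fun u : ℝ => ((expNegInvGlue (1 - u ^ 2) : ℝ) : ℂ)) *
              (1 / (2 * Real.pi) * ∫ u : ℝ, ‖weilMellin (fun x : ℝ => ∑ m ∈ Finset.Icc 1 M,
                a m * ((ε : ℂ)⁻¹ * ((expNegInvGlue (1 - ((x - Real.log (m : ℝ)) / ε) ^ 2) : ℝ) : ℂ)))
                  (1 / 2 + u * I)‖ ^ 2 * (reDigammaQuarter u - reDigammaQuarter 0))) -
          (16 * (∫ u : ℝ, expNegInvGlue (1 - u ^ 2) * Real.cosh (ε * u / 2)) ^ 4 * (ε * M) ^ 2 /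
                weilNorm2Sq (fun u : ℝ => ((expNegInvGlue (1 - u ^ 2) : ℝ) : ℂ)) ^ 2 +
              (1 + 2 * (Real.log 4 + 4)) / 4) * (∑ m ∈ Finset.Icc 1 M, ‖a m‖ ^ 2)) ≤
      (weilQuadratic (fun x : ℝ => ∑ m ∈ Finset.Icc 1 M,
        a m * ((ε : ℂ)⁻¹ * ((expNegInvGlue (1 - ((x - Real.log (m : ℝ)) / ε) ^ 2) : ℝ) : ℂ)))).re := by
  intro ε hε M a hM hw
  have hMpos : 0 < M := hM
  -- the four stubs, the exact identity and the pole coefficient (BEFORE naming the atoms)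
  have hCS := stub_polarCS M a
  have hPo := stub_poincare_explicit M a
  have hHe := stub_helson_upper M a
  have hAr := stub_arch_window ε hε M a hw
  have hQ := weilQuadratic_comb_re_exactWindow ε hε M a hM hw
  have hPol := weilPolarTerm_comb_re ε hε M a
  obtain ⟨hF0, hF1, hFpos⟩ := weilMellin_dilBump_zero_one ε hε
  rw [hF0, hF1] at hPol
  obtain ⟨hSm_le, hSp_le⟩ := norm_polarSums_le_dich M a
  rw [hQ, hPol, hAr]
  -- names for the real atoms
  set N₀ : ℝ := weilNorm2Sq (fun u : ℝ => ((expNegInvGlue (1 - u ^ 2) : ℝ) : ℂ)) with hN₀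
  set F : ℝ := ∫ u : ℝ, expNegInvGlue (1 - u ^ 2) * Real.cosh (ε * u / 2) with hFdef
  set L : ℝ := ∑ m ∈ Finset.Icc 1 M, ‖a m‖ ^ 2 with hL
  set D : ℝ := ∑ m ∈ Finset.Icc 1 M, ∑ n ∈ Finset.Icc 1 (M / m),
      (ArithmeticFunction.vonMangoldt n : ℝ) * ‖a (n * m) - ((Real.sqrt n : ℂ))⁻¹ * a m‖ ^ 2 with hDdef
  set H : ℝ := 2 * (∑ m ∈ Finset.Icc 1 M, ∑ n ∈ Finset.Icc 1 (M / m),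
      ((ArithmeticFunction.vonMangoldt n : ℝ) : ℂ) / (Real.sqrt n : ℂ) * a (n * m) * conj (a m)).re with hH
  set X : ℝ := ∑ m ∈ Finset.Icc 1 M, (m : ℝ) * Real.log m * ‖a m‖ ^ 2 with hX
  set Am : ℝ := ∑ m ∈ Finset.Icc 1 M, ‖a m‖ / Real.sqrt m with hAm
  set Ap : ℝ := ∑ m ∈ Finset.Icc 1 M, ‖a m‖ * Real.sqrt m with hAp
  set P : ℝ := 1 / (2 * Real.pi) * ∫ u : ℝ, ‖weilMellin (fun x : ℝ => ∑ m ∈ Finset.Icc 1 M,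
      a m * ((ε : ℂ)⁻¹ * ((expNegInvGlue (1 - ((x - Real.log (m : ℝ)) / ε) ^ 2) : ℝ) : ℂ)))
        (1 / 2 + u * I)‖ ^ 2 * (reDigammaQuarter u - reDigammaQuarter 0) with hP
  set Sm : ℂ := ∑ m ∈ Finset.Icc 1 M, a m * ((Real.sqrt (m : ℝ) : ℝ) : ℂ)⁻¹ with hSm
  set Sp : ℂ := ∑ m ∈ Finset.Icc 1 M, a m * ((Real.sqrt (m : ℝ) : ℝ) : ℂ) with hSp
  set c : ℝ := Real.log M + 1 + Real.log Real.pi - reDigammaQuarter 0 with hc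
  set CP : ℝ := 2 * (Real.log 4 + 4) with hCP
  have hN₀pos : 0 < N₀ := weilNorm2Sq_shapeBump_pos
  have hMr : (0 : ℝ) < (M : ℝ) := by exact_mod_cast hMpos
  have hL0 : 0 ≤ L := Finset.sum_nonneg fun _ _ => by positivity
  have hD0 : 0 ≤ D := Finset.sum_nonneg fun _ _ => Finset.sum_nonneg fun _ _ =>
    mul_nonneg ArithmeticFunction.vonMangoldt_nonneg (by positivity)
  have hAm0 : 0 ≤ Am := Finset.sum_nonneg fun _ _ => by positivity
  have hAp0 : 0 ≤ Ap := Finset.sum_nonneg fun _ _ => by positivity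
  have hCP0 : 0 ≤ CP := by positivity
  -- `U = ε⁻¹ N₀ = ψ_ε(0) > 0`
  have hεU : 0 < ε⁻¹ * N₀ := mul_pos (inv_pos.2 hε) hN₀pos
  set U : ℝ := ε⁻¹ * N₀ with hU
  -- polar: `Re P(k) = 2F² Re(Sm conj Sp) ≥ -2F² Am Ap`
  have hPolar_ge : -(2 * F ^ 2 * (Am * Ap)) ≤ 2 * ((F : ℂ) * conj (F : ℂ) * (Sm * conj Sp)).re := by
    rw [re_ofReal_mul_conj_mul_dich]
    have h1 : |(Sm * conj Sp).re| ≤ ‖Sm‖ * ‖Sp‖ := by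
      calc |(Sm * conj Sp).re| ≤ ‖Sm * conj Sp‖ := Complex.abs_re_le_norm _
        _ = ‖Sm‖ * ‖Sp‖ := by rw [norm_mul, Complex.norm_conj]
    have h2 : ‖Sm‖ * ‖Sp‖ ≤ Am * Ap := mul_le_mul hSm_le hSp_le (norm_nonneg _) hAm0
    have h3 : -(Am * Ap) ≤ (Sm * conj Sp).re := by
      have := neg_abs_le (Sm * conj Sp).re
      linarith
    have hF2 : 0 ≤ 2 * F ^ 2 := by positivity
    have := mul_le_mul_of_nonneg_left h3 hF2
    linarith
  -- AM–GM: `2F² Am Ap ≤ U D / 2 + C U L`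
  have hShadow := polar_shadow_le_dich (F := F) hεU hMr hL0 hD0 hCP0 (mul_nonneg hAm0 hAp0) hCS hPo
  -- Helson: `U H ≤ U ((log M + 1) L − D)`
  have hHel : U * H ≤ U * ((Real.log M + 1) * L - D) := mul_le_mul_of_nonneg_left hHe hεU.le
  -- the constants in terms of `U`
  have hεN : ε / N₀ = U⁻¹ := by
    rw [hU, mul_inv, inv_inv]
    ring
  have hFM : 16 * F ^ 4 * (ε * M) ^ 2 / N₀ ^ 2 = 16 * F ^ 4 * (M : ℝ) ^ 2 / U ^ 2 := by
    rw [hU]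
    field_simp
  rw [hεN, hFM]
  -- the left side, expanded: `U·D/2 − c·U·L + P − K·U·L` (using `U·U⁻¹ = 1`)
  have e : U * (D / 2 - (c * L - U⁻¹ * P) - (16 * F ^ 4 * (M : ℝ) ^ 2 / U ^ 2 + (1 + CP) / 4) * L) =
      U * D / 2 - c * (U * L) + P - (16 * F ^ 4 * (M : ℝ) ^ 2 / U ^ 2 + (1 + CP) / 4) * (U * L) := by
    field_simp
    ring
  rw [e, hc]
  linarith [hPolar_ge, hShadow, hHel]

/-- **The dichotomy (corollary).** For `0 < ε`, `1 ≤ M`, `2ε(M+1) ≤ 1`: if `a` lies OFF the soft cone, i.e.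
`D(a) > 2Δ(a) + 2C‖a‖²`, then the window cell holds at `a`: `0 ≤ Re Q(g)` (indeed `> 0`). Hence Theorem B
(the exact window) is equivalent to its restriction to the soft cone `D ≤ 2Δ + 2C‖a‖²`. [folklore] -/
theorem window_dichotomy : ∀ ε : ℝ, 0 < ε → ∀ (M : ℕ) (a : ℕ → ℂ), 1 ≤ M → 2 * ε * ((M : ℝ) + 1) ≤ 1 →
    2 * ((Real.log M + 1 + Real.log Real.pi - reDigammaQuarter 0) * (∑ m ∈ Finset.Icc 1 M, ‖a m‖ ^ 2) -
            ε / weilNorm2Sq (fun u : ℝ => ((expNegInvGlue (1 - u ^ 2) : ℝ) : ℂ)) *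
              (1 / (2 * Real.pi) * ∫ u : ℝ, ‖weilMellin (fun x : ℝ => ∑ m ∈ Finset.Icc 1 M,
                a m * ((ε : ℂ)⁻¹ * ((expNegInvGlue (1 - ((x - Real.log (m : ℝ)) / ε) ^ 2) : ℝ) : ℂ)))
                  (1 / 2 + u * I)‖ ^ 2 * (reDigammaQuarter u - reDigammaQuarter 0))) +
        2 * (16 * (∫ u : ℝ, expNegInvGlue (1 - u ^ 2) * Real.cosh (ε * u / 2)) ^ 4 * (ε * M) ^ 2 /
              weilNorm2Sq (fun u : ℝ => ((expNegInvGlue (1 - u ^ 2) : ℝ) : ℂ)) ^ 2 +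
            (1 + 2 * (Real.log 4 + 4)) / 4) * (∑ m ∈ Finset.Icc 1 M, ‖a m‖ ^ 2) <
      (∑ m ∈ Finset.Icc 1 M, ∑ n ∈ Finset.Icc 1 (M / m),
        (ArithmeticFunction.vonMangoldt n : ℝ) * ‖a (n * m) - ((Real.sqrt n : ℂ))⁻¹ * a m‖ ^ 2) →
    0 ≤ (weilQuadratic (fun x : ℝ => ∑ m ∈ Finset.Icc 1 M,
        a m * ((ε : ℂ)⁻¹ * ((expNegInvGlue (1 - ((x - Real.log (m : ℝ)) / ε) ^ 2) : ℝ) : ℂ)))).re := by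
  intro ε hε M a hM hw hcone
  have h := window_coercivity ε hε M a hM hw
  have hU : 0 ≤ ε⁻¹ * weilNorm2Sq (fun u : ℝ => ((expNegInvGlue (1 - u ^ 2) : ℝ) : ℂ)) :=
    mul_nonneg (inv_nonneg.2 hε.le) (weilNorm2Sq_nonneg _)
  refine le_trans (mul_nonneg hU ?_) h
  linarith

end Summit.RiemannHypothesis.RiemannHypothesis.Theorems.WeilCombBohrFejer

end
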